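import Summits.SmoothPoincare4.SmoothPoincare4.Theorems.SymplecticOrigamiGromovRecognitionRelEndStubCapModelX3

/-!
# Wedge cap for `GromovRecognitionRelEnd` — `X` is connected; the modified form on `M`
(stub `stub_capModel` of line `cross-cap-laurent`, crux `SymplecticOrigami.GromovRecognitionRelEnd`,
item stmt-SmoothPoincare4-11009)

* CONNECTED: the image of the connected `M` is dense in `X` (chart points off the axes are points
  of the end, and the off-axis sets are dense in the charts), so `X` is connected;
* the MODIFIED FORM `sfMod` on `M`: `sf` on `K`, `ψ^* ΩM` on the end — it equals `sf` on the open
  truncation `K ∪ {‖ψ‖ < R₁}` (H10 and `ΩM = ω₀` on the ball of radius `R₁`), hence is smooth and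
  closed (locality of smoothness and of `d`), and it tames `J` (on the end beyond `R₁` because
  `J = ψ*(i ⊕ i)` there and `ΩM` tames `i ⊕ i`; `dψ` is injective by H4 + H10).
-/

noncomputable section

-- the registered namespace `Summit.SmoothPoincare4.SmoothPoincare4.Theorems…` repeats a component
set_option linter.dupNamespace false

open scoped Manifold ContDiff Topology
open Set Function Filter TopologicalSpace Literature.Geometry.Kaehler Literature.Geometry.Symplectic
  Literature.Topology.FourManifolds

namespace Summit.SmoothPoincare4.SmoothPoincare4.Theorems.GromovRecognitionRelEnd.CrossCapLaurent

namespace CapModel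

/-- Model space `ℝ⁴ = ℂ²` (coordinates `0,1` = `z₁`, `2,3` = `z₂`). -/
local notation "E4" => EuclideanSpace ℝ (Fin 4)

/-! ## Density of the off-axis sets -/

/-- `{p | p i ≠ 0}` is dense in `ℝ⁴`. [folklore] -/
theorem dense_coord_ne (i : Fin 4) : Dense {p : E4 | p i ≠ 0} := by
  intro x
  rw [Metric.mem_closure_iff]
  intro ε hε
  by_cases hx : x i ≠ 0
  · exact ⟨x, hx, by rw [dist_self]; exact hε⟩
  · refine ⟨x + (ε / 2) • EuclideanSpace.single i (1 : ℝ), ?_, ?_⟩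
    · show (x + (ε / 2) • EuclideanSpace.single i (1 : ℝ)) i ≠ 0
      simp only [not_not] at hx
      simp [hx, hε.ne']
    · rw [dist_eq_norm, sub_add_cancel_left, norm_neg, norm_smul, EuclideanSpace.single,
        PiLp.norm_single, norm_one, mul_one, Real.norm_eq_abs, abs_of_pos (by positivity)]
      linarith

/-- `{p | p i ≠ 0 ∧ p j ≠ 0}` is dense in `ℝ⁴`. [folklore] -/
theorem dense_coord_ne₂ (i j : Fin 4) : Dense {p : E4 | p i ≠ 0 ∧ p j ≠ 0} :=
  (dense_coord_ne i).inter_of_isOpen_left (dense_coord_ne j)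
    (isOpen_ne_fun (continuous_apply i |>.comp (PiLp.continuous_ofLp 2 _)) continuous_const)

/-- In an open piece, every point is a limit of points of the trace of a dense set. [folklore] -/
theorem mem_closure_preimage_val {U : Opens E4} {T : Set E4} (hT : Dense T) (b : U) :
    b ∈ closure (Subtype.val ⁻¹' T : Set U) :=
  (hT.preimage U.isOpenEmbedding'.isOpenMap) b

variable {R₁ : ℝ} [hR : Fact (0 < R₁)]
  {M : Type} [TopologicalSpace M] [T2Space M] [ChartedSpace E4 M] [IsManifold (𝓡 4) ∞ M]
  {sf : MForm (𝓡 4) M ℝ 2} {K : Set M} {R : ℝ} {ψ : M → E4} {χ : E4 → M}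
  {J : AlmostComplexStructure (𝓡 4) ∞ M} (H : EndHyp sf K R ψ χ R₁ J)

/-- `instance`: the cap is nonempty. [folklore] -/
instance : Nonempty (Cap R₁) := ⟨κC oC⟩

/-! ## `X` is connected -/

/-- A corner-chart point off both axes is a `V`-chart point off the axis. [folklore] -/
theorem κC_eq_κV_of_ne {c : OC R₁} (h2 : r2 c.1 ≠ 0) :
    κC c = (κV (mkV (inv2 c.1)) : Cap R₁) ∧ (mkV (inv2 c.1) : OV R₁).1 = inv2 c.1 := by
  have hm := inv2_mapsC c.2 h2
  refine ⟨?_, val_toOpens hm.1⟩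
  rw [κC_eq_κV_iff, mkV, val_toOpens hm.1]
  exact ⟨hm.2, by
    apply Subtype.ext; rw [mkC, val_toOpens (by rw [inv2_inv2 h2]; exact c.2), inv2_inv2 h2]⟩

/-- **The image of `M` is dense in `X`.** [folklore] -/
theorem dense_range_inl : Dense (range (dX H).inl) := by
  have hcl : ∀ {U : Opens E4} (F : U → (dX H).Glued) (_ : Continuous F) (S : Set U) (b : U),
      b ∈ closure S → (∀ b' ∈ S, F b' ∈ range (dX H).inl) → F b ∈ closure (range (dX H).inl) :=
    fun F hF S b hb hS => closure_mono (by rintro _ ⟨b', hb', rfl⟩; exact hS b' hb')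
      (map_mem_closure hF hb fun b' hb' => mem_image_of_mem F hb')
  intro y
  rcases (dX H).exists_inl_or_inr y with ⟨x, rfl⟩ | ⟨c, rfl⟩
  · exact subset_closure (mem_range_self x)
  rcases (dC1 R₁).exists_inl_or_inr c with ⟨y₁, rfl⟩ | ⟨c', rfl⟩
  · rcases (dVH R₁).exists_inl_or_inr y₁ with ⟨b, rfl⟩ | ⟨b, rfl⟩
    · refine hcl (fun b : OV R₁ => (dX H).inr (κV b)) ((dX H).continuous_inr.comp
        (((dC1 R₁).continuous_inl).comp (dVH R₁).continuous_inl)) _ b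
        (mem_closure_preimage_val (dense_coord_ne 0) b) ?_
      intro b' hb'
      have h1 : r1 b'.1 ≠ 0 := (r1_ne_zero_iff _).2 (Or.inl hb')
      show (dX H).inr (κV b') ∈ _
      rw [κV_eq_ofCoord h1, inr_ofCoord H (Or.inl (sq_lt_r1_inv1 h1 b'.2))]
      exact mem_range_self _
    · refine hcl (fun b : OH R₁ => (dX H).inr (κH b)) ((dX H).continuous_inr.comp
        (((dC1 R₁).continuous_inl).comp (dVH R₁).continuous_inr)) _ b
        (mem_closure_preimage_val (dense_coord_ne 2) b) ?_
      intro b' hb'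
      have h2 : r2 b'.1 ≠ 0 := (r2_ne_zero_iff _).2 (Or.inl hb')
      show (dX H).inr (κH b') ∈ _
      rw [κH_eq_ofCoord h2, inr_ofCoord H (Or.inr (sq_lt_r2_inv2 h2 b'.2))]
      exact mem_range_self _
  · refine hcl (fun c : OC R₁ => (dX H).inr (κC c)) ((dX H).continuous_inr.comp
      (dC1 R₁).continuous_inr) _ c' (mem_closure_preimage_val (dense_coord_ne₂ 0 2) c') ?_
    rintro c ⟨hc0, hc2⟩
    have h1 : r1 c.1 ≠ 0 := (r1_ne_zero_iff _).2 (Or.inl hc0)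
    have h2 : r2 c.1 ≠ 0 := (r2_ne_zero_iff _).2 (Or.inl hc2)
    obtain ⟨heq, hval⟩ := κC_eq_κV_of_ne h2
    have h1' : r1 (mkV (inv2 c.1) : OV R₁).1 ≠ 0 := by rw [hval, r1_inv2]; exact h1
    show (dX H).inr (κC c) ∈ _
    rw [heq, κV_eq_ofCoord h1', inr_ofCoord H (Or.inl (sq_lt_r1_inv1 h1' (mkV (inv2 c.1)).2))]
    exact mem_range_self _

/-- **`X = M ∪ Cap` is connected** (for connected `M`). [folklore] -/
theorem connectedSpace_X [ConnectedSpace M] : ConnectedSpace (dX H).Glued := by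
  rw [connectedSpace_iff_univ, ← (dense_range_inl H).closure_eq]
  exact (isConnected_range (dX H).continuous_inl).closure

/-! ## The modified form on `M` -/

/-- **The modified form** `sfMod`: `sf` on `K`, `ψ^* ΩM` on the end. [folklore] -/
def sfMod (_ : EndHyp sf K R ψ χ R₁ J) : MForm (𝓡 4) M ℝ 2 := fun x =>
  open scoped Classical in if x ∈ K then sf x else (ΩM R₁).pullback (𝓡 4) ψ x

omit hR [T2Space M] in
/-- `sfMod` on the end. [folklore] -/
theorem sfMod_of_not_mem {x : M} (hx : x ∉ K) : sfMod H x = (ΩM R₁).pullback (𝓡 4) ψ x := by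
  simp only [sfMod, hx, if_false]

omit hR [T2Space M] in
/-- `sfMod = sf` on the open truncation `K ∪ {‖ψ‖ < R₁}` (H10 and `ΩM = ω₀` there). [folklore] -/
theorem sfMod_eq_sf {x : M} (hx : x ∈ K ∪ {x | x ∈ Kᶜ ∧ ‖ψ x‖ < R₁}) : sfMod H x = sf x := by
  by_cases hK : x ∈ K
  · simp only [sfMod, hK, if_true]
  · rcases hx with h | ⟨-, h⟩
    · exact absurd h hK
    rw [sfMod_of_not_mem H hK]
    refine twoForm_ext fun v w => ?_
    rw [← GlueF.apply_pair_mfderiv, ΩM_apply_of_norm_le R₁ h.le, H.pullback_eq x hK]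

omit hR [T2Space M] in
/-- Near a point of the truncation, `sfMod = sf`. [folklore] -/
theorem sfMod_eventuallyEq_sf {x : M} (hx : x ∈ K ∪ {x | x ∈ Kᶜ ∧ ‖ψ x‖ < R₁}) :
    ∀ᶠ x' in 𝓝 x, sfMod H x' = sf x' := by
  filter_upwards [(H.isOpen_trunc R₁ H.lt_R₁).mem_nhds hx] with x' hx'
  exact sfMod_eq_sf H hx'

omit hR in
/-- Near a point of the end, `sfMod = ψ^* ΩM`. [folklore] -/
theorem sfMod_eventuallyEq_pullback {x : M} (hx : x ∉ K) :
    ∀ᶠ x' in 𝓝 x, sfMod H x' = (ΩM R₁).pullback (𝓡 4) ψ x' := by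
  filter_upwards [H.isOpen_compl_K.mem_nhds hx] with x' hx'
  exact sfMod_of_not_mem H hx'

omit hR [T2Space M] in
/-- Every point is in the truncation or in the end. [folklore] -/
theorem mem_trunc_or_not_mem (_ : EndHyp sf K R ψ χ R₁ J) (x : M) :
    x ∈ K ∪ {x | x ∈ Kᶜ ∧ ‖ψ x‖ < R₁} ∨ x ∉ K := by
  by_cases hK : x ∈ K
  · exact Or.inl (Or.inl hK)
  · exact Or.inr hK

omit hR in
/-- **`sfMod` is smooth.** [folklore] -/
theorem isSmoothForm_sfMod : IsSmoothForm (sfMod H) := by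
  intro x
  rcases mem_trunc_or_not_mem H x with hx | hx
  · exact MForm.SmoothAt.congr_of_eventuallyEq (H.smooth x : sf.SmoothAt x)
      ((sfMod_eventuallyEq_sf H hx).mono fun _ h => h.symm)
  · have hψ : ∀ᶠ z in 𝓝 x, ContMDiffAt (𝓡 4) 𝓘(ℝ, E4) ∞ ψ z := by
      filter_upwards [H.isOpen_compl_K.mem_nhds hx] with z hz
      exact H.contMDiffAt_ψ hz
    exact (MForm.SmoothAt.pullback hψ ((isSmoothForm_models R₁).1 _)).congr_of_eventuallyEq
      ((sfMod_eventuallyEq_pullback H hx).mono fun _ h => h.symm)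

omit hR in
/-- **`sfMod` is closed.** [folklore] -/
theorem isClosedForm_sfMod : IsClosedForm (sfMod H) := by
  funext x
  rcases mem_trunc_or_not_mem H x with hx | hx
  · rw [mextDeriv_congr_of_eventuallyEq (sfMod_eventuallyEq_sf H hx), show mextDeriv sf = 0 from H.closed]
  · have hψ : ∀ᶠ z in 𝓝 x, ContMDiffAt (𝓡 4) 𝓘(ℝ, E4) ∞ ψ z := by
      filter_upwards [H.isOpen_compl_K.mem_nhds hx] with z hz
      exact H.contMDiffAt_ψ hz
    rw [mextDeriv_congr_of_eventuallyEq (sfMod_eventuallyEq_pullback H hx),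
      mextDeriv_pullback_apply hψ ((isSmoothForm_models R₁).1 _),
      show mextDeriv (ΩM R₁) = 0 from (isClosedForm_models R₁).1, MForm.pullback_zero]

omit hR [T2Space M] in
/-- `dψ` is injective on the end (H4 + H10; copy of Disproof `mfderiv_injective_of_pullbackClause`).
[folklore] -/
theorem mfderiv_ψ_ne_zero (H : EndHyp sf K R ψ χ R₁ J) {x : M} (hx : x ∉ K)
    {v : TangentSpace (𝓡 4) x} (hv : v ≠ 0) : mfderiv (𝓡 4) 𝓘(ℝ, E4) ψ x v ≠ 0 := by
  -- adapted from Cruxes/GromovRecognitionRelEnd/Disproof.lean (mfderiv_injective_of_pullbackClause)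
  intro h0
  obtain ⟨w, hw⟩ := H.nondeg x v hv
  rw [H.pullback_eq x hx v w, h0] at hw
  have h : stdSymplecticForm (0 : E4) (mfderiv (𝓡 4) 𝓘(ℝ, E4) ψ x w) = 0 := by
    simp [stdSymplecticForm]
  exact hw h

omit hR [T2Space M] in
/-- On the end beyond `R₁`, `dψ (J v) = (i ⊕ i)(dψ v)`. [folklore] -/
theorem mfderiv_ψ_J (H : EndHyp sf K R ψ χ R₁ J) {x : M} (hx : x ∉ K) (hR₁ : R₁ < ‖ψ x‖)
    (v : TangentSpace (𝓡 4) x) :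
    mfderiv (𝓡 4) 𝓘(ℝ, E4) ψ x (J x v) = I4 (mfderiv (𝓡 4) 𝓘(ℝ, E4) ψ x v) := by
  rw [H.Jstd x hx hR₁ v _ rfl, I4_apply]

omit hR [T2Space M] in
/-- **`J` is tamed by `sfMod`.** [cite: McDuffSalamon2017, §4.1 (4.1.1)] -/
theorem tame_sfMod : J.IsTamedBy (sfMod H) := by
  intro x v hv
  by_cases hK : x ∈ K
  · rw [sfMod_eq_sf H (Or.inl hK)]; exact H.tame x v hv
  rw [sfMod_of_not_mem H hK, ← GlueF.apply_pair_mfderiv]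
  by_cases hn : ‖ψ x‖ ≤ R₁
  · rw [ΩM_apply_of_norm_le R₁ hn, ← H.pullback_eq x hK]; exact H.tame x v hv
  · rw [mfderiv_ψ_J H hK (not_le.1 hn)]
    exact (models_I4_pos R₁ (ψ x) (mfderiv_ψ_ne_zero H hK hv)).1

end CapModel

/-- **Registered helper sub-goal `helper_capModelConnectedModel`** (file `X4` of stub `stub_capModel`): under the
hypotheses of the stub, the glued model is a CONNECTED closed `4`-manifold in which `M` is open and dense. [folklore] -/
theorem helper_capModelConnectedModel :
    ∀ (M : Type) [TopologicalSpace M] [T2Space M] [SecondCountableTopology M]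
      [ChartedSpace (EuclideanSpace ℝ (Fin 4)) M] [IsManifold (𝓡 4) ∞ M] [ConnectedSpace M]
      (sf : Literature.Geometry.Kaehler.MForm (𝓡 4) M ℝ 2) (K : Set M) (R : ℝ)
      (ψ : M → EuclideanSpace ℝ (Fin 4)) (χ : EuclideanSpace ℝ (Fin 4) → M),
      Literature.Geometry.Kaehler.IsSmoothForm sf → Literature.Geometry.Kaehler.IsClosedForm sf →
      (∀ x (v : TangentSpace (𝓡 4) x), v ≠ 0 → ∃ w, sf x ![v, w] ≠ 0) →
      (∀ R', R ≤ R' → IsCompact (K ∪ {x | ‖ψ x‖ ≤ R'})) →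
      ContMDiffOn (𝓡 4) 𝓘(ℝ, EuclideanSpace ℝ (Fin 4)) ∞ ψ Kᶜ →
      ContMDiffOn 𝓘(ℝ, EuclideanSpace ℝ (Fin 4)) (𝓡 4) ∞ χ
        (Metric.closedBall (0 : EuclideanSpace ℝ (Fin 4)) R)ᶜ →
      Set.BijOn ψ Kᶜ (Metric.closedBall (0 : EuclideanSpace ℝ (Fin 4)) R)ᶜ →
      (∀ x, x ∈ Kᶜ → χ (ψ x) = x) →
      (∀ x, x ∈ Kᶜ → ∀ v w, sf x ![v, w] = Literature.Geometry.Symplectic.stdSymplecticForm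
        (mfderiv (𝓡 4) 𝓘(ℝ, EuclideanSpace ℝ (Fin 4)) ψ x v)
        (mfderiv (𝓡 4) 𝓘(ℝ, EuclideanSpace ℝ (Fin 4)) ψ x w)) →
      (∀ R', R < R' → IsOpen (K ∪ {x | x ∈ Kᶜ ∧ ‖ψ x‖ < R'})) →
      ∀ (R₁ : ℝ) (J : Literature.Geometry.Symplectic.AlmostComplexStructure (𝓡 4) ∞ M),
      R < R₁ → 0 < R₁ → J.IsTamedBy sf →
      (∀ x, x ∈ Kᶜ → R₁ < ‖ψ x‖ → ∀ (v : TangentSpace (𝓡 4) x) (a : EuclideanSpace ℝ (Fin 4)),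
          a = mfderiv (𝓡 4) 𝓘(ℝ, EuclideanSpace ℝ (Fin 4)) ψ x v →
          mfderiv (𝓡 4) 𝓘(ℝ, EuclideanSpace ℝ (Fin 4)) ψ x (J x v) =
            WithLp.toLp 2 ![-(a 1), a 0, -(a 3), a 2]) →
      ∃ (X : Type) (_ : TopologicalSpace X) (_ : T2Space X) (_ : SecondCountableTopology X)
        (_ : CompactSpace X) (_ : ConnectedSpace X) (_ : ChartedSpace (EuclideanSpace ℝ (Fin 4)) X)
        (_ : IsManifold (𝓡 4) ∞ X) (ι : M → X), Function.Injective ι ∧ IsOpenMap ι ∧ Dense (Set.range ι) := by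
  intro M _ _ _ _ _ _ sf K R ψ χ h2 h3 h4 h5 h6 h7 h8 h9 h10 hopen R₁ J hR₁ hR₁pos hJt hJstd
  haveI : Fact (0 < R₁) := ⟨hR₁pos⟩
  let H : CapModel.EndHyp sf K R ψ χ R₁ J :=
    { smooth := h2, closed := h3, nondeg := h4, ends := h5, smooth_ψ := h6, smooth_χ := h7, bij := h8,
      left_inv := h9, pullback_eq := h10, isOpen_trunc := hopen, lt_R₁ := hR₁, R₁_pos := hR₁pos,
      tame := hJt, Jstd := hJstd }
  exact ⟨(CapModel.dX H).Glued, inferInstance, CapModel.t2Space_X H, CapModel.secondCountable_X H,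
    CapModel.compactSpace_X H, CapModel.connectedSpace_X H, inferInstance, inferInstance,
    (CapModel.dX H).inl, (CapModel.dX H).inl_injective, (CapModel.dX H).isOpenMap_inl,
    CapModel.dense_range_inl H⟩

end Summit.SmoothPoincare4.SmoothPoincare4.Theorems.GromovRecognitionRelEnd.CrossCapLaurent
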